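import Mathlib
import Summits.BirchSwinnertonDyer.Rank1Residual.ManinAdditive.TwoEisensteinRankOneLaws
import Summits.BirchSwinnertonDyer.BirchSwinnertonDyer.Theorems.ManinLocalTwoThreeTwoEisensteinModTwoDecomposition
import Summits.BirchSwinnertonDyer.BirchSwinnertonDyer.Theorems.ManinLocalTwoThreeFamilyIsolationOddCongruence
import Literature.NumberTheory.EllipticCurves.PastenSpectralDegreeProofs
import Literature.NumberTheory.EllipticCurves.NewformsHeckeProofs
import HarnessLib

/-!
# E-imc-87 `RankOneForcesOddCongruence` holds: 2-Eisenstein rank one at level `4p` forces an odd congruence number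

Summit `BirchSwinnertonDyer`, route `ManinLocalTwoThree` (cell bsd-f2-manin), deciding crux C2 `ManinOddAtFour`
(stmt-BirchSwinnertonDyer-22967, skeleton v11 `kato_shift_two`, stub 6d `stub_blindTameOptimalOddDegree` and its imc
chain «`J₀(2p)(ℚ)[2] = 0 ⟹ e_{2p}^{new} = 0 ⟹ 2-Eisenstein RANK ONE at 4p ⟹ 2 ∤ r_f ⟹ (ARS) 2 ∤ deg φ ⟹ (ČNS) 2 ∤ c₀`»,
MEMO-imc §21–§22).  PROVED HERE, unconditionally: the typed implication E-imc-87
`…ManinAdditive.TwoEisenstein.RankOneForcesOddCongruence := FourPTwoEisensteinRankOne → FourPFamilyCongruenceOdd`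
(refuter-1 §R58: THEOREM-candidate, F-4/F-7), i.e. the arrow «rank one ⟹ `2 ∤ r_f`» of that chain, for the newform
`f = f_{E'_m}` of `E'_m : y² = x³ − 2m x² + p x` (`p = m² + 4` prime, `m ≡ 1 (mod 4)`, so `p ≡ 5 (mod 8)`).

THE ARGUMENT (no perfect pairing `S₂(ℤ) × 𝕋 → ℤ` and no `𝕋 ⊗ ℤ₂`-idempotent is needed).  `L = S₂(Γ₀(4p); ℤ)`,
`c = ⟨f, f⟩`, `r = r_f = #(L/(ℤf + (ℤf)^⊥))` (tree `congruenceNumber`).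
(1) FINITENESS `r ≠ 0`: `r ∣ ∏ η` (Pasten, tree `ModularParametrizationData.congruenceNumber_dvd_prod_heckeCongruenceModulus`,
multiplicity one inside) and each `η ≠ 0`.  (2) `ψ(g) := r⟨f, g⟩/⟨f, f⟩ ∈ ℤ` for `g ∈ L` (Lagrange in the finite quotient +
`mem_span_sup_integralOrthogonal0_iff`); `ψ` is additive, `ψ(f) = r`, and `ψ(T_ℓ y) = a_ℓ ψ(y)` is EVEN (`T_ℓ` self-adjoint,
`a_ℓ(f)` even by the rational 2-torsion of `E'_m`: `FamilyHeckeInputs_holds`).  (3) `g ↦ ψ(g) mod r` is an additive map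
`L → ℤ/r` with kernel exactly `ℤf + (ℤf)^⊥`, so its image has `r` elements: it is ONTO, and some `g₁ ∈ L` has
`ψ(g₁) ≡ 1 (mod r)`.  (4) `f` is 2-Eisenstein-nilpotent (`T_ℓ f = a_ℓ f ∈ 2L`) and `f ∉ 2L` (`a₁(f) = 1`), so the
rank-one law puts the line through `f`, and the MOD-2 DECOMPOSITION (sibling file `…TwoEisensteinModTwoDecomposition`,
multi-operator Fitting lemma on the finite module `L/2L`) writes `g₁ = ε f + Σ T_ℓ z_ℓ + 2k`.  (5) Applying `ψ`:
`ψ(g₁) = ε r + (even) + 2ψ(k) ≡ ε r (mod 2)`; were `r` even, `ψ(g₁)` would be even AND `≡ 1 (mod r)`, hence odd —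
contradiction.  So `r_f` is odd.
Nothing about BSD, Manin's conjecture or any Manin constant is asserted or proved here; E-imc-85 (rank one) and
E-imc-82 (Yazdani's expectation) remain OPEN laws — only the implication between them is now a theorem.
-/

-- `Summit.BirchSwinnertonDyer.BirchSwinnertonDyer` is the mandated summit-side namespace (single-conjunct summit).
set_option linter.dupNamespace false

noncomputable section

open scoped MatrixGroups ModularForm ComplexConjugate
open CongruenceSubgroup UpperHalfPlane
open Literature.NumberTheory.EllipticCurves Literature.NumberTheory.EllipticCurves.ModularForms
open Summit.BirchSwinnertonDyer.Rank1Residual.ManinAdditive.TwoEisenstein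

namespace Summit.BirchSwinnertonDyer.BirchSwinnertonDyer.Theorems.ManinLocalTwoThree

/-- On the family, `m ≡ 1 (mod 4)` and `p = m² + 4` force `p ≡ 5 (mod 8)` (the unramified class of E-imc-85). [folklore] -/
theorem family_prime_mod_eight {m : ℤ} {p : ℕ} (hm : m % 4 = 1) (hp : (p : ℤ) = m ^ 2 + 4) : p % 8 = 5 := by
  obtain ⟨j, hj⟩ : ∃ j : ℤ, m = 4 * j + 1 := ⟨m / 4, by omega⟩
  have h8 : ∃ X : ℤ, (p : ℤ) = 8 * X + 5 := ⟨2 * j ^ 2 + j, by rw [hp, hj]; ring⟩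
  obtain ⟨X, hX⟩ := h8
  omega

/-- **E-imc-87 holds: `RankOneForcesOddCongruence`** — the law E-imc-85 `FourPTwoEisensteinRankOne` (the
2-Eisenstein-nilpotent vectors of `S₂(Γ₀(4p); 𝔽₂)` form a line, `p ≡ 5 (mod 8)`) implies Yazdani's expectation E-imc-82
`FourPFamilyCongruenceOdd` (the newform of `E'_m : y² = x³ − 2m x² + (m² + 4) x`, `m ≡ 1 (mod 4)`, `m² + 4` prime, has ODD
congruence number).  See the module docstring for the proof (finiteness of `r_f` from Pasten's product; the integer
functional `ψ = r_f⟨f, ·⟩/⟨f, f⟩` is onto `ℤ/r_f` modulo `r_f` and even on every `T_ℓ(S₂(ℤ))`; the mod-2 decomposition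
`g = ε f + Σ T_ℓ z + 2k` under the line).  Unconditional; level `4p` and the family enter only through `p ≡ 5 (mod 8)` and
the parity `2 ∣ a_ℓ(f)`. [cite: AgasheRibetStein2012, §2.1 (definition of `r_f`)]
[cite: PastenShimura2024, §5.6 p. 19 (second proof of Thm. 5.5: `r_f ∣ ∏ η`)] -/
theorem rankOneForcesOddCongruence_holds : RankOneForcesOddCongruence := by
  intro h85 m p hNZ D hm hp hpp
  classical
  set f : CuspForm (Gamma0 (4 * p)) 2 := D.f with hf
  set L : Submodule ℤ (CuspForm (Gamma0 (4 * p)) 2) := integralCuspForms0 (4 * p) 2 with hL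
  set c : ℂ := peterssonProduct (Gamma0 (4 * p)) 2 f f with hc
  have hfL : f ∈ L := D.f_mem_integralCuspForms0
  obtain ⟨-, -, hf1⟩ := D.isNewformOf.1
  have hf0 : f ≠ 0 := D.f_ne_zero
  have hc0 : c ≠ 0 := fun h0 ↦ hf0 (eq_zero_of_peterssonProduct_self_eq_zero 2 f h0)
  -- Hecke data at the odd primes away from the level: `T_ℓ f = a • f` with `a` even
  have hHecke : ∀ (ℓ : ℕ) (hℓ : ℓ.Prime), Odd ℓ → ¬ ℓ ∣ 4 * p →
      ∃ a : ℤ, (haveI : NeZero ℓ := ⟨hℓ.ne_zero⟩; heckeT (Gamma0 (4 * p)) 2 ℓ) f = (a : ℂ) • f ∧ (2 : ℤ) ∣ a := by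
    intro ℓ hℓ hodd hℓN
    have hℓp : ℓ ≠ p := fun h ↦ hℓN (h ▸ dvd_mul_left ℓ 4)
    obtain ⟨a, ha⟩ := (mem_integralCuspForms0.mp hfL) ℓ
    obtain ⟨-, -, hT, h2⟩ := FamilyHeckeInputs_holds m p D ℓ hℓ a hm hp hpp hodd hℓp ha
    exact ⟨a, hT, h2⟩
  -- `f` is 2-Eisenstein-nilpotent and not twice-integral
  have hfnil : IsTwoEisensteinNilpotent (4 * p) f := by
    refine ⟨hfL, fun ℓ hℓ hodd hℓN ↦ ?_⟩
    obtain ⟨a, hT, k2, rfl⟩ := hHecke ℓ hℓ hodd hℓN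
    refine ⟨1, k2 • f, L.smul_mem _ hfL, ?_⟩
    rw [pow_one, hT, Int.cast_mul, Int.cast_ofNat, mul_smul, Int.cast_smul_eq_zsmul]
  have hfnt : ¬ IsTwiceIntegral (4 * p) f := by
    rintro ⟨h, hh, hfh⟩
    obtain ⟨z, hz⟩ := (mem_integralCuspForms0.mp hh) 1
    have h1 : (qExpansion 1 ⇑f).coeff 1 = 2 * (qExpansion 1 ⇑h).coeff 1 := by
      rw [hfh, qExpansion_coeff_smul]
    rw [show (qExpansion 1 ⇑f).coeff 1 = 1 from hf1, show (qExpansion 1 ⇑h).coeff 1 = cuspCoeff h 1 from rfl,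
      ← hz] at h1
    have h1' : (1 : ℤ) = 2 * z := by exact_mod_cast h1
    omega
  -- the rank-one law puts the line through `f`
  obtain ⟨g₀, -, -, hline₀⟩ := h85 p hpp (family_prime_mod_eight hm hp)
  have hfg₀ : IsTwiceIntegral (4 * p) (f - g₀) := (hline₀ f hfnil).resolve_left hfnt
  have hline : ∀ g, IsTwoEisensteinNilpotent (4 * p) g →
      IsTwiceIntegral (4 * p) g ∨ IsTwiceIntegral (4 * p) (g - f) := by
    intro g hg
    rcases hline₀ g hg with h | ⟨u, hu, hgu⟩
    · exact Or.inl h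
    · obtain ⟨v, hv, hfv⟩ := hfg₀
      refine Or.inr ⟨u - v, sub_mem hu hv, ?_⟩
      rw [smul_sub, ← hgu, ← hfv]
      abel
  -- (1) finiteness: `r ≠ 0`
  set r : ℕ := congruenceNumber f with hr
  have hr0 : r ≠ 0 := by
    intro h0
    have hdvd := D.congruenceNumber_dvd_prod_heckeCongruenceModulus
    rw [← hf, ← hr, h0, zero_dvd_iff, Finset.prod_eq_zero_iff] at hdvd
    obtain ⟨P, hP, hP0⟩ := hdvd
    exact D.heckeCongruenceModulus_ne_zero
      ((finite_minimalPrimes_anemicHeckeRing (4 * p) 2).mem_toFinset.mp (Finset.mem_of_mem_erase hP))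
      (Finset.ne_of_mem_erase hP) hP0
  -- (2) the quotient `Q = L/(ℤf + (ℤf)^⊥)` has `r` elements; `ψ(g) = r⟨f,g⟩/⟨f,f⟩ ∈ ℤ`
  set H : Submodule ℤ L := ((ℤ ∙ f) ⊔ integralOrthogonal0 f).comap L.subtype with hH
  have hcardQ : Nat.card (L ⧸ H) = r := by rw [hr, congruenceNumber_def]
  haveI : Finite (L ⧸ H) := Nat.finite_of_card_ne_zero (by rw [hcardQ]; exact hr0)
  have key : ∀ g ∈ L, ∃ n : ℤ, (n : ℂ) * c = (r : ℂ) * peterssonProduct (Gamma0 (4 * p)) 2 f g := by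
    intro g hg
    have hq : H.mkQ (r • (⟨g, hg⟩ : L)) = 0 := by
      rw [map_nsmul, ← hcardQ]
      exact addOrderOf_dvd_iff_nsmul_eq_zero.mp (addOrderOf_dvd_natCard _)
    rw [Submodule.mkQ_apply, Submodule.Quotient.mk_eq_zero, hH, Submodule.mem_comap,
      Submodule.subtype_apply, Submodule.coe_smul_of_tower] at hq
    obtain ⟨n, hn⟩ := (mem_span_sup_integralOrthogonal0_iff hfL (nsmul_mem hg r)).mp hq
    rw [← Nat.cast_smul_eq_nsmul ℂ, peterssonProduct_smul_right] at hn
    exact ⟨n, by rw [hc]; exact hn.symm⟩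
  choose! ψ hψ using key
  have hψadd : ∀ g ∈ L, ∀ h ∈ L, ψ (g + h) = ψ g + ψ h := by
    intro g hg h hh
    have e : ((ψ (g + h) : ℤ) : ℂ) * c = ((ψ g + ψ h : ℤ) : ℂ) * c := by
      rw [hψ _ (add_mem hg hh), peterssonProduct_add_right, mul_add, ← hψ g hg, ← hψ h hh, Int.cast_add, add_mul]
    exact_mod_cast mul_right_cancel₀ hc0 e
  have hψf : ψ f = r := by
    have e := hψ f hfL
    rw [← hc] at e
    exact_mod_cast mul_right_cancel₀ hc0 e
  -- `ψ(T_ℓ y) = a_ℓ ψ(y)` is even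
  have hψT : ∀ (ℓ : ℕ) (hℓ : ℓ.Prime), Odd ℓ → ¬ ℓ ∣ 4 * p → ∀ y ∈ L,
      (haveI : NeZero ℓ := ⟨hℓ.ne_zero⟩; heckeT (Gamma0 (4 * p)) 2 ℓ) y ∈ L ∧
        ∃ n : ℤ, ψ ((haveI : NeZero ℓ := ⟨hℓ.ne_zero⟩; heckeT (Gamma0 (4 * p)) 2 ℓ) y) = 2 * n := by
    intro ℓ hℓ hodd hℓN y hy
    haveI : NeZero ℓ := ⟨hℓ.ne_zero⟩
    obtain ⟨a, hT₀, k2, rfl⟩ := hHecke ℓ hℓ hodd hℓN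
    have hT : heckeT (Gamma0 (4 * p)) 2 ℓ f = ((2 * k2 : ℤ) : ℂ) • f := hT₀
    have hTy : heckeT (Gamma0 (4 * p)) 2 ℓ y ∈ L := heckeT_mem_integralCuspForms0 ℓ hℓ hℓN hy
    refine ⟨hTy, k2 * ψ y, ?_⟩
    have e1 := hψ _ hTy
    have hsa := heckeT_selfAdjoint_holds (4 * p) 2 ℓ hℓ hℓN f y
    rw [hT, peterssonProduct_smul_left, map_intCast] at hsa
    rw [← hsa] at e1
    have e2 := hψ y hy
    have e3 : ((ψ (heckeT (Gamma0 (4 * p)) 2 ℓ y) : ℤ) : ℂ) * c = ((2 * (k2 * ψ y) : ℤ) : ℂ) * c := by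
      rw [e1]
      push_cast
      linear_combination (2 * (k2 : ℂ)) * e2.symm
    exact_mod_cast mul_right_cancel₀ hc0 e3
  -- (3) `g ↦ ψ(g) mod r` : `L →+ ℤ/r` has kernel `ℤf + (ℤf)^⊥`, hence is onto
  haveI : NeZero r := ⟨hr0⟩
  let φ : L →+ ZMod r := AddMonoidHom.mk' (fun g ↦ ((ψ g : ℤ) : ZMod r)) fun g h ↦ by
    change ((ψ ((g : CuspForm (Gamma0 (4 * p)) 2) + h) : ℤ) : ZMod r) = _
    rw [hψadd _ g.2 _ h.2, Int.cast_add]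
  have hφ : ∀ g : L, φ g = ((ψ g : ℤ) : ZMod r) := fun g ↦ rfl
  have hker : φ.ker = H.toAddSubgroup := by
    ext g
    rw [AddMonoidHom.mem_ker, Submodule.mem_toAddSubgroup, hH, Submodule.mem_comap,
      Submodule.subtype_apply, mem_span_sup_integralOrthogonal0_iff hfL g.2, hφ,
      ZMod.intCast_zmod_eq_zero_iff_dvd]
    constructor
    · rintro ⟨n, hn⟩
      refine ⟨n, ?_⟩
      have e := hψ g g.2
      rw [hn, Int.cast_mul, Int.cast_natCast, mul_assoc] at e
      exact (mul_left_cancel₀ (Nat.cast_ne_zero.mpr hr0) e).symm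
    · rintro ⟨n, hn⟩
      refine ⟨n, ?_⟩
      have e : ((ψ g : ℤ) : ℂ) * c = (((r : ℤ) * n : ℤ) : ℂ) * c := by
        rw [hψ g g.2, hn, Int.cast_mul, Int.cast_natCast, mul_assoc]
      exact_mod_cast mul_right_cancel₀ hc0 e
  have hrange : φ.range = ⊤ := by
    refine AddSubgroup.eq_top_of_card_eq _ ?_
    rw [← Nat.card_congr (QuotientAddGroup.quotientKerEquivRange φ).toEquiv, hker, Nat.card_zmod]
    exact hcardQ
  obtain ⟨g₁, hg₁⟩ : ∃ g₁ : L, φ g₁ = 1 := by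
    have h1 : (1 : ZMod r) ∈ φ.range := by rw [hrange]; exact AddSubgroup.mem_top _
    exact AddMonoidHom.mem_range.mp h1
  have hg₁' : (r : ℤ) ∣ 1 - ψ g₁ := by
    rw [hφ, show (1 : ZMod r) = ((1 : ℤ) : ZMod r) by rw [Int.cast_one], ZMod.intCast_eq_intCast_iff_dvd_sub] at hg₁
    exact hg₁
  -- (4) the mod-2 decomposition of `g₁`
  obtain ⟨ε, y, hy, k, hk, hdec⟩ := integral_decomp_of_twoEisensteinLine f hline g₁.2
  have hyψ : y ∈ L ∧ ∃ n : ℤ, ψ y = 2 * n := by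
    refine Submodule.iSup_induction _ (motive := fun y ↦ y ∈ L ∧ ∃ n : ℤ, ψ y = 2 * n) hy ?_ ⟨L.zero_mem, 0, ?_⟩ ?_
    · rintro ⟨ℓ, hℓ, hodd, hℓN⟩ y hy
      obtain ⟨z, hz, rfl⟩ := Submodule.mem_map.mp hy
      rw [LinearMap.coe_restrictScalars]
      exact hψT ℓ hℓ hodd hℓN z hz
    · have e := hψ 0 L.zero_mem
      rw [peterssonProduct_zero_right, mul_zero] at e
      have e' : ((ψ 0 : ℤ) : ℂ) = 0 := (mul_eq_zero.mp e).resolve_right hc0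
      rw [mul_zero]
      exact_mod_cast e'
    · rintro y₁ y₂ ⟨h₁, n₁, e₁⟩ ⟨h₂, n₂, e₂⟩
      exact ⟨add_mem h₁ h₂, n₁ + n₂, by rw [hψadd _ h₁ _ h₂, e₁, e₂]; ring⟩
  obtain ⟨hyL, n, hn⟩ := hyψ
  -- (5) evaluate `ψ` on `g₁ = ε f + y + 2k`
  have hg₁eq : (g₁ : CuspForm (Gamma0 (4 * p)) 2) = ε • f + y + (2 : ℤ) • k := by
    rw [← Int.cast_smul_eq_zsmul ℂ (2 : ℤ) k, Int.cast_ofNat, ← hdec]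
    abel
  have hψg₁ : ψ g₁ = ε * r + ψ y + 2 * ψ k := by
    have e := hψ g₁ g₁.2
    have epg : peterssonProduct (Gamma0 (4 * p)) 2 f g₁ =
        (ε : ℂ) * c + peterssonProduct (Gamma0 (4 * p)) 2 f y +
          ((2 : ℤ) : ℂ) * peterssonProduct (Gamma0 (4 * p)) 2 f k := by
      rw [hg₁eq, peterssonProduct_add_right, peterssonProduct_add_right, ← Int.cast_smul_eq_zsmul ℂ ε,
        peterssonProduct_smul_right, ← Int.cast_smul_eq_zsmul ℂ (2 : ℤ), peterssonProduct_smul_right]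
    rw [epg] at e
    have ey := hψ y hyL
    have ek := hψ k hk
    have e' : ((ψ g₁ : ℤ) : ℂ) * c = ((ε * r + ψ y + 2 * ψ k : ℤ) : ℂ) * c := by
      rw [e]
      push_cast
      linear_combination (-1 : ℂ) * ey - 2 * ek
    exact_mod_cast mul_right_cancel₀ hc0 e'
  -- parity
  rw [Nat.odd_iff]
  by_contra hodd
  have h2r : (2 : ℤ) ∣ (r : ℤ) := by omega
  have hA : (2 : ℤ) ∣ 1 - ψ g₁ := dvd_trans h2r hg₁'
  have hB : (2 : ℤ) ∣ ψ g₁ := by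
    rw [hψg₁, hn]
    exact dvd_add (dvd_add (dvd_mul_of_dvd_right h2r ε) (dvd_mul_right 2 n)) (dvd_mul_right 2 _)
  have h21 : (2 : ℤ) ∣ 1 := by simpa using dvd_add hA hB
  omega

end Summit.BirchSwinnertonDyer.BirchSwinnertonDyer.Theorems.ManinLocalTwoThree

end
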